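import Summits.ResolutionOfSingularities.ResolutionOfSingularities.Theorems.RadicialJungCleanModelsRegularTypeDerivationsRegular
import Summits.ResolutionOfSingularities.ResolutionOfSingularities.Theorems.RadicialJungCleanModelsLogContentIdealValued
import Summits.ResolutionOfSingularities.ResolutionOfSingularities.Theorems.RadicialJungCleanModelsCriticalLocusClosedRegular
import Summits.ResolutionOfSingularities.ResolutionOfSingularities.Theorems.RadicialJungCleanModelsT2Plumbing
import Literature.AlgebraicGeometry.Resolution.GiraudLogJacobianIdeal
import Literature.AlgebraicGeometry.Resolution.MonomialOrderReductionUnit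
import Literature.AlgebraicGeometry.Resolution.EmbeddedResolutionCurvesInSurfaces
import HarnessLib

/-!
# Route `RadicialJung`, crux `CleanModels` (stmt-15917): Giraud's critical set `E(f)` under
# morphisms and point blowing ups — `E(f ∘ e) = e⁻¹ E(f)` (T2 brick B2, over an arbitrary field)

Support file (OURS) for PROGRAMME-clean-dim2 / T2 (`HOME/L/res-L0-w81-pv-2/g5/T2-ARCHITECTURE.md`,
brick B2), line `via-clean-models` of crux `DescentPerfectToAll` (stmt-0549). Nothing here is a
statement of Hironaka's manuscript.

Giraud (Bull. SMF 111 (1983), proof of Thm. 2.4, p. 117): "Puisque l'on n'éclate que des points de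
`E(df_{n-1})`, `E(df_n)` est le sous-schéma réduit sous-jacent à l'image inverse de `E(df_{n-1})`".
With `E(f)` in derivation form (`derivCriticalSet`: the points `ξ` with `D f ∈ 𝔪_ξ` for every
derivation `D` of `𝒪_{X,ξ}`), over a regular scheme locally of finite type over ANY field of
characteristic `p` (so that every `Ω_{𝒪_{X,ξ}/ℤ}` is projective: formal smoothness over `𝔽_p`):

* `derivation_apply_algebraMap_mem_map_derivJacobianIdeal` — for `Ω[O⁄ℤ]` projective, ANY
  `O`-algebra `T` and ANY derivation `D` of `T`: `D f ∈ J(O, f)·T` (the core lemma of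
  `RadicialJungCleanModelsLogContentIdealValued.lean` with no boundary);
* `preimage_derivCriticalSet_subset` — **`π⁻¹ E(f) ⊆ E(π^* f)` for EVERY morphism `π : X₁ → X`**
  into such an `X` (stalk maps are local);
* `mem_derivCriticalSet_of_isIso_stalkMap` — where the stalk map is an isomorphism (and `X₁` is
  also regular of finite type over `k`) the converse holds;
* `derivCriticalSet_eq_preimage_of_isBlowup` — **`E(f ∘ e) = e⁻¹ E(f)` for the blowing up `e` of
  a closed point OF `E(f)`** (off the centre `e` is a local isomorphism,
  `IsBlowup.isIso_stalkMap_of_not_mem_support`); FALSE for centres outside `E(f)` (`f = y` at the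
  origin of the plane: `E(x y′)` has a new point), which is why Phase A of T2 uses the locus form
  F-75c of Stacks 0BIC;
* `derivCriticalSet_eq_preimage_of_isPointBlowupComposition_overField` — the same for a finite
  composition of point blowing ups with all centres over `E(f)`
  (`IsPointBlowupComposition (derivCriticalSet X f) π`); this is the `k`-scheme case of the
  hypothesis `hB2` of `RadicialJungCleanModelsGiraudPhaseA.lean` (res-L1-s13-pv-1), whose Phase A
  is re-assembled here with it:
* `phaseA_overField` — **T2 brick B8 for surfaces over a field, modulo F-75c and the two remaining
  inputs `E(f)` closed / nowhere dense**: a composition of point blowing ups over `E(f)` after which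
  `E(f₁) = π⁻¹E(f)` is a strict normal crossings divisor (the T2 skeleton's `stub_phaseA`).

## References
* J. Giraud, Forme normale d'une fonction sur une surface de caractéristique positive, Bull. Soc.
  Math. France 111 (1983) 109–124: Déf. 1.2, Thm. 2.4 (proof). [Giraud1983]
* The Stacks Project, Tag 02OS (blowing up is an isomorphism off the centre). [StacksProject]
-/

noncomputable section

set_option linter.dupNamespace false -- mandated namespace of this single-conjunct summit

open CategoryTheory AlgebraicGeometry TopologicalSpace IsLocalRing KaehlerDifferential
open Literature.AlgebraicGeometry.Resolution

namespace Summit.ResolutionOfSingularities.ResolutionOfSingularities.Theorems.RadicialJung.CleanModels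

open Scheme.IdealSheafData

universe u v

/-! ## Ring level: every derivation of an `O`-algebra is controlled by `J(O, f)` -/

/-- **`D f ∈ J(O, f)·T` for every derivation `D` of an `O`-algebra `T`**, `Ω[O⁄ℤ]` projective
(core lemma with empty boundary). [cite: Giraud1983, 1.1 (2)] -/
theorem derivation_apply_algebraMap_mem_map_derivJacobianIdeal {O : Type u} [CommRing O]
    [Module.Projective O Ω[O⁄ℤ]] {T : Type v} [CommRing T] [Algebra O T] (D : Derivation ℤ T T)
    (f : O) :
    D (algebraMap O T f) ∈ (derivJacobianIdeal O f).map (algebraMap O T) := by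
  have h := derivation_apply_sub_sum_mem_map_span_nullDerivation (x := (Fin.elim0 : Fin 0 → O))
    (δ := (Fin.elim0 : Fin 0 → Derivation ℤ O O)) (fun i => i.elim0) (D.compAlgebraMap O) f
  simp only [Finset.univ_eq_empty, Finset.sum_empty, sub_zero] at h
  refine Ideal.map_mono ?_ h
  refine Ideal.span_mono ?_
  rintro _ ⟨D', -, rfl⟩
  exact ⟨D', rfl⟩

/-- Consequence: if `J(O, f) ⊆ 𝔪_O` and `O → T` is a local homomorphism of local rings, every
derivation of `T` maps the image of `f` into `𝔪_T`. [cite: Giraud1983, Déf. 1.2] -/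
theorem derivation_apply_algebraMap_mem_maximalIdeal {O : Type u} [CommRing O] [IsLocalRing O]
    [Module.Projective O Ω[O⁄ℤ]] {T : Type v} [CommRing T] [IsLocalRing T] [Algebra O T]
    [IsLocalHom (algebraMap O T)] {f : O} (hf : derivJacobianIdeal O f ≤ maximalIdeal O)
    (D : Derivation ℤ T T) : D (algebraMap O T f) ∈ maximalIdeal T :=
  (map_maximalIdeal_le (algebraMap O T))
    (Ideal.map_mono hf (derivation_apply_algebraMap_mem_map_derivJacobianIdeal D f))

/-! ## Stalks of a regular scheme over a field have projective absolute differentials -/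

/-- For `X` regular and locally of finite type over a field `k` of characteristic `p`, the module
of absolute Kähler differentials of every stalk is projective (the stalk is formally smooth over
`𝔽_p`: `formallySmooth_zmod_of_isRegularLocalRing_of_essFiniteType`). [cite: StacksProject, Tag 031I] -/
theorem projective_kaehler_stalk (p : ℕ) [Fact p.Prime] (k : Type) [Field k] [CharP k p]
    (X : Scheme.{0}) (q : X ⟶ Spec (.of k)) [LocallyOfFiniteType q] (hreg : Scheme.IsRegular X)
    (ξ : X) : Module.Projective (X.presheaf.stalk ξ) Ω[X.presheaf.stalk ξ⁄ℤ] := by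
  obtain ⟨_, _⟩ := exists_algebra_essFiniteType_stalk k X q ξ
  haveI : IsRegularLocalRing (X.presheaf.stalk ξ) := hreg ξ
  haveI : CharP (X.presheaf.stalk ξ) p :=
    charP_of_injective_algebraMap (algebraMap k (X.presheaf.stalk ξ)).injective p
  letI : Algebra (ZMod p) (X.presheaf.stalk ξ) := ZMod.algebra (X.presheaf.stalk ξ) p
  haveI := formallySmooth_zmod_of_isRegularLocalRing_of_essFiniteType p k (X.presheaf.stalk ξ)
  exact projective_kaehler_int_of_zmod p

/-! ## Scheme level -/

section SchemeLevel

variable (p : ℕ) [Fact p.Prime] (k : Type) [Field k] [CharP k p]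

include p in
/-- **`π⁻¹ E(f) ⊆ E(π^* f)` for every morphism `π : X₁ → X`** with `X` regular and locally of
finite type over a field: if every derivation of `𝒪_{X,π ξ′}` maps `f` into the maximal ideal,
so does every derivation of `𝒪_{X₁,ξ′}` with `π^* f` (the stalk map is local and
`Ω_{𝒪_{X,πξ′}}` is projective). [cite: Giraud1983, Déf. 1.2 and Thm. 2.4 (proof)] -/
theorem preimage_derivCriticalSet_subset (X : Scheme.{0}) (q : X ⟶ Spec (.of k))
    [LocallyOfFiniteType q] (hreg : Scheme.IsRegular X) {X₁ : Scheme.{0}} (π : X₁ ⟶ X)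
    (f : Γ(X, ⊤)) :
    π.base ⁻¹' derivCriticalSet X f ⊆ derivCriticalSet X₁ (π.appTop f) := by
  intro ξ' hξ
  rw [Set.mem_preimage, derivCriticalSet, Set.mem_setOf_eq] at hξ
  rw [derivCriticalSet, Set.mem_setOf_eq, derivJacobianIdeal, Ideal.span_le, Set.range_subset_iff]
  intro D
  haveI := projective_kaehler_stalk p k X q hreg (π.base ξ')
  letI : Algebra (X.presheaf.stalk (π.base ξ')) (X₁.presheaf.stalk ξ') :=
    (π.stalkMap ξ').hom.toAlgebra
  haveI : IsLocalHom (algebraMap (X.presheaf.stalk (π.base ξ')) (X₁.presheaf.stalk ξ')) :=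
    inferInstanceAs (IsLocalHom (π.stalkMap ξ').hom)
  have h := derivation_apply_algebraMap_mem_maximalIdeal hξ D
  have hgerm : algebraMap (X.presheaf.stalk (π.base ξ')) (X₁.presheaf.stalk ξ')
      (X.presheaf.germ ⊤ (π.base ξ') trivial f) = X₁.presheaf.germ ⊤ ξ' trivial (π.appTop f) := by
    change (π.stalkMap ξ').hom _ = _
    exact Scheme.Hom.germ_stalkMap_apply π ⊤ ξ' trivial f
  rw [hgerm] at h
  exact h

include p in
/-- **Where the stalk map is an isomorphism the converse holds**: for `π : X₁ → X` between regular
schemes locally of finite type over `k` and `ξ′` with `π.stalkMap ξ′` an isomorphism,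
`ξ′ ∈ E(π^* f)` implies `π ξ′ ∈ E(f)`. [cite: Giraud1983, Déf. 1.2] -/
theorem mem_derivCriticalSet_of_isIso_stalkMap (X : Scheme.{0}) {X₁ : Scheme.{0}} (π : X₁ ⟶ X)
    (q₁ : X₁ ⟶ Spec (.of k)) [LocallyOfFiniteType q₁] (hreg₁ : Scheme.IsRegular X₁)
    (f : Γ(X, ⊤)) {ξ' : X₁} [IsIso (π.stalkMap ξ')]
    (hξ' : ξ' ∈ derivCriticalSet X₁ (π.appTop f)) : π.base ξ' ∈ derivCriticalSet X f := by
  rw [derivCriticalSet, Set.mem_setOf_eq] at hξ'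
  rw [derivCriticalSet, Set.mem_setOf_eq, derivJacobianIdeal, Ideal.span_le, Set.range_subset_iff]
  intro D
  haveI := projective_kaehler_stalk p k X₁ q₁ hreg₁ ξ'
  let e : X.presheaf.stalk (π.base ξ') ≅ X₁.presheaf.stalk ξ' := asIso (π.stalkMap ξ')
  letI : Algebra (X₁.presheaf.stalk ξ') (X.presheaf.stalk (π.base ξ')) := e.inv.hom.toAlgebra
  haveI : IsLocalHom (algebraMap (X₁.presheaf.stalk ξ') (X.presheaf.stalk (π.base ξ'))) := by
    refine ⟨fun a ha => ?_⟩
    have ha' := ha.map e.hom.hom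
    have : e.hom.hom (e.inv.hom a) = a := e.inv_hom_id_apply a
    change IsUnit (e.hom.hom (e.inv.hom a)) at ha'
    rwa [this] at ha'
  have h := derivation_apply_algebraMap_mem_maximalIdeal hξ' D
  have hsm : (π.stalkMap ξ').hom (X.presheaf.germ ⊤ (π.base ξ') trivial f) =
      X₁.presheaf.germ ⊤ ξ' trivial (π.appTop f) :=
    Scheme.Hom.germ_stalkMap_apply π ⊤ ξ' trivial f
  have hgerm : algebraMap (X₁.presheaf.stalk ξ') (X.presheaf.stalk (π.base ξ'))
      (X₁.presheaf.germ ⊤ ξ' trivial (π.appTop f)) = X.presheaf.germ ⊤ (π.base ξ') trivial f := by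
    change e.inv.hom _ = _
    rw [← hsm]
    exact e.hom_inv_id_apply _
  rw [hgerm] at h
  exact h

include p in
/-- **`E(f ∘ e) = e⁻¹ E(f)` for the blowing up of a closed point of `E(f)`** (`X`, `X₁` regular and
locally of finite type over `k`). [cite: Giraud1983, Thm. 2.4 (proof)] [cite: StacksProject, Tag 02OS] -/
theorem derivCriticalSet_eq_preimage_of_isBlowup (X : Scheme.{0}) (q : X ⟶ Spec (.of k))
    [LocallyOfFiniteType q] (hreg : Scheme.IsRegular X) {X₁ : Scheme.{0}} {π : X₁ ⟶ X}
    (q₁ : X₁ ⟶ Spec (.of k)) [LocallyOfFiniteType q₁] (hreg₁ : Scheme.IsRegular X₁)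
    {x : X} {hx : IsClosed ({x} : Set X)} (hπ : IsBlowup π (vanishingIdeal ⟨{x}, hx⟩))
    (f : Γ(X, ⊤)) (hxE : x ∈ derivCriticalSet X f) :
    derivCriticalSet X₁ (π.appTop f) = π.base ⁻¹' derivCriticalSet X f := by
  refine le_antisymm ?_ (preimage_derivCriticalSet_subset p k X q hreg π f)
  intro ξ' hξ'
  by_cases hx' : π.base ξ' = x
  · rw [Set.mem_preimage, hx']; exact hxE
  · have hns : π.base ξ' ∉ (vanishingIdeal (⟨{x}, hx⟩ : Closeds X)).support := by
      rw [← SetLike.mem_coe, coe_support_vanishingIdeal]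
      exact hx'
    haveI := hπ.isIso_stalkMap_of_not_mem_support hns
    exact mem_derivCriticalSet_of_isIso_stalkMap p k X π q₁ hreg₁ f hξ'

include p in
/-- **`E(f ∘ π) = π⁻¹ E(f)` for a composition of point blowing ups with all centres over `E(f)`**
(`X` regular, quasi-compact, locally of finite type over `k`, of dimension `2`; the stages are then
regular, `isRegular_of_isPointBlowupComposition`). [cite: Giraud1983, Thm. 2.4 (proof)] -/
theorem derivCriticalSet_eq_preimage_of_isPointBlowupComposition_overField (X : Scheme.{0})
    (q : X ⟶ Spec (.of k)) [LocallyOfFiniteType q] (hreg : Scheme.IsRegular X) (f : Γ(X, ⊤)) :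
    ∀ {X₁ : Scheme.{0}} {π : X₁ ⟶ X}, IsPointBlowupComposition (derivCriticalSet X f) π →
      derivCriticalSet X₁ (π.appTop f) = π.base ⁻¹' derivCriticalSet X f := by
  intro X₁ π h
  haveI : IsLocallyNoetherian X := LocallyOfFiniteType.isLocallyNoetherian q
  induction h with
  | nil => ext ξ; simp
  | @cons X'' X' τ σ x' hx' hσ hne hT hτ ih =>
    haveI : IsProper σ := hσ.isProper inferInstance
    haveI : LocallyOfFiniteType (σ ≫ q) := inferInstance
    have hreg' : Scheme.IsRegular X' := isRegular_of_isPointBlowupComposition hreg hσ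
    haveI : IsLocallyNoetherian X' := hσ.isLocallyNoetherian
    haveI : IsProper τ := hτ.isProper
    haveI : LocallyOfFiniteType ((τ ≫ σ) ≫ q) := inferInstance
    have hreg'' : Scheme.IsRegular X'' :=
      isRegular_of_isPointBlowupComposition hreg
        (IsPointBlowupComposition.cons τ σ x' hx' hσ hne hT hτ)
    have hx'E : x' ∈ derivCriticalSet X' (σ.appTop f) := by rw [ih]; exact hT
    have h1 := derivCriticalSet_eq_preimage_of_isBlowup p k X' (σ ≫ q) hreg' ((τ ≫ σ) ≫ q) hreg''
      hτ (σ.appTop f) hx'E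
    have happ : (τ ≫ σ).appTop f = τ.appTop (σ.appTop f) := by
      rw [Scheme.Hom.comp_appTop]; rfl
    rw [happ, h1, ih]
    ext ξ
    simp only [Set.mem_preimage, Scheme.Hom.comp_apply]


/-! ## Phase A over a field (T2 brick B8, with res-L1-s13-pv-1's `exists_phaseA` pattern) -/

include p in
/-- **Phase A of T2 over a field.** For `X` quasi-compact, regular of
dimension `2`, locally of finite type over a field `k` of characteristic `p`, and `f ∈ Γ(X, 𝒪_X)`
with `E(f)` closed and nowhere dense: F-75c (`Stacks0BIC_embeddedResolutionCurvesInSurfaces_locus`,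
hypothesis `h75c`) applied to the reduced closed subscheme on `E(f)` gives a composition
`π : X₁ → X` of blowing ups at closed points over `E(f)` with `π⁻¹E(f)` a strict normal crossings
divisor, and `E(π^* f) = π⁻¹E(f)` by `derivCriticalSet_eq_preimage_of_isPointBlowupComposition_overField`
— the T2 skeleton's `stub_phaseA` modulo `E(f)` closed / nowhere dense. (`X` is Noetherian and
excellent: of finite type over a field.) [cite: StacksProject, Tag 0BIC] [cite: Giraud1983, Thm. 2.4 (proof)] -/
theorem phaseA_overField (h75c : Stacks0BIC_embeddedResolutionCurvesInSurfaces_locus.{0})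
    (X : Scheme.{0}) [CompactSpace X] (q : X ⟶ Spec (.of k)) [LocallyOfFiniteType q]
    (hreg : Scheme.IsRegular X) (hdim : topologicalKrullDim X = 2) (f : Γ(X, ⊤))
    (hEcl : IsClosed (derivCriticalSet X f)) (hEnd : IsNowhereDense (derivCriticalSet X f)) :
    ∃ (X₁ : Scheme.{0}) (π : X₁ ⟶ X), IsPointBlowupComposition (derivCriticalSet X f) π ∧
      derivCriticalSet X₁ (π.appTop f) = π.base ⁻¹' derivCriticalSet X f ∧
      IsStrictNormalCrossingsDivisor X₁ (derivCriticalSet X₁ (π.appTop f)) := by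
  haveI : IsLocallyNoetherian X := LocallyOfFiniteType.isLocallyNoetherian q
  haveI : IsNoetherian X := ⟨⟩
  have hexc : Scheme.IsExcellent X :=
    Scheme.IsExcellent.of_locallyOfFiniteType q
      (Scheme.isExcellent_Spec_of_isExcellentRing _ (isExcellentRing_of_field _))
  set Z : X.IdealSheafData := vanishingIdeal ⟨derivCriticalSet X f, hEcl⟩ with hZdef
  have hZ : (Z.support : Set X) = derivCriticalSet X f := by
    rw [hZdef, coe_support_vanishingIdeal]
    rfl
  obtain ⟨X₁, π₁, hπ, -, hsnc⟩ := h75c X Z hreg hexc hdim (by rw [hZ]; exact hEnd)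
  rw [hZ] at hπ hsnc
  have hE := derivCriticalSet_eq_preimage_of_isPointBlowupComposition_overField p k X q hreg f hπ
  refine ⟨X₁, π₁, hπ, hE, ?_⟩
  rw [hE]
  exact hsnc

end SchemeLevel

end Summit.ResolutionOfSingularities.ResolutionOfSingularities.Theorems.RadicialJung.CleanModels

end
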